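import Summits.KontsevichZagierPeriods.KontsevichZagierPeriods.Theorems.HurwitzMicroSectorsNormalFormPrincipleBoxUnicoordReductionK2
import Summits.KontsevichZagierPeriods.KontsevichZagierPeriods.Theorems.HurwitzMicroSectorsNormalFormPrincipleSplitMoves

/-!
# `NormalFormPrinciple` (stmt-KontsevichZagierPeriods-3869), line `SketchIdeator1` —
# the leaf `stub_boxRigidity` in dimension two, level one: polynomial boxes collapse to rational points

Pure proof file (stub `boxPoly_exists_pt` of the dimension-two layer, lead seat c7; `--supports` the
crux). A box representation `[(0,1)ᵐ, p]` with a POLYNOMIAL integrand `p ∈ ℚ[x₀,…,x_{m−1}]` (any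
`m`) differs by Kontsevich–Zagier relations from the point representation `[pt, q]` over `ℝ⁰`
(domain `univ : Set (Fin 0 → ℝ)`, constant integrand `q`) for a rational number `q` (namely
`q = ∫_{[0,1]ᵐ} p`):

* glue the open box to the closed-cube representation `[[0,1]ᵐ, p/1]` of the regular rational
  function `p/1` (`Unicoord.of_sub_of_rep_mem_relations`, rule 1a: the faces are null);
* integrate out ALL `m` variables by Newton–Leibniz moves along the last coordinate
  (`Unicoord.exists_integrateOut` with `M = 0`, denominator `1`), landing on `[[0,1]⁰, p']` with
  `p' ∈ ℚ[∅]` a constant `C q` (`MvPolynomial.eq_C_of_isEmpty`);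
* `[0,1]⁰ = univ` and the integrand of `[[0,1]⁰, C q]` is the constant `q`, so congruence
  (`KZ.of_sub_of_mem_relations_of_eqOn`, rule 1b) identifies it with every `[pt, q]`.

Sources: M. Kontsevich, D. Zagier, *Periods* (2001), §1.2 rules (1)–(3); J. Ayoub, *Periods and the
conjectures of Grothendieck and Kontsevich–Zagier*, EMS Newsl. 91 (2014), Def. 10. No definitions
are introduced.
-/

noncomputable section

open MeasureTheory Set
open Literature.NumberTheory.Transcendental Literature.NumberTheory.Transcendental.KZ
open Literature.ModelTheory.ExponentialFields (IsSemialgebraic)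

namespace Summit.KontsevichZagierPeriods.HurwitzMicroSectors.NormalFormPrinciple.PiBox.LevelOne

/-- The closed unit cube of `ℝ⁰` is the point (all coordinate conditions are vacuous). [folklore] -/
theorem cube_zero_eq_univ : KZ.cube 0 = (univ : Set (Fin 0 → ℝ)) :=
  eq_univ_of_forall fun _ i => i.elim0

/-- **Integrating out all the variables of a polynomial on the closed cube.** For every
`p ∈ ℚ[x₀,…,x_{n−1}]` the cube representation `[[0,1]ⁿ, p]` differs by KZ relations from the
constant representation `[[0,1]⁰, c]` over `ℝ⁰` for some `c ∈ ℚ`: `n` Newton–Leibniz moves along the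
last coordinate (`Unicoord.exists_integrateOut` with no surviving variables and denominator `1`);
a polynomial in no variables is a constant. [cite: KontsevichZagier2001, §1.2 rule (3)] -/
theorem exists_poly_rep_sub_const_rep_mem_relations {n : ℕ} (p : MvPolynomial (Fin n) ℚ) :
    ∃ c : ℚ, KZ.of (RFun.poly p).rep - KZ.of (RFun.const c : RFun 0).rep ∈ KZ.relations := by
  obtain ⟨k, rfl⟩ : ∃ k, n = 0 + k := ⟨n, (Nat.zero_add n).symm⟩
  have hq : ∀ x ∈ KZ.cube 0, MvPolynomial.aeval x (1 : MvPolynomial (Fin 0) ℚ) ≠ 0 :=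
    fun x _ => by simp
  obtain ⟨p', hp'⟩ := Unicoord.exists_integrateOut (M := 0) 1 hq k (RFun.poly p)
    (by simp [RFun.poly])
  obtain ⟨c, rfl⟩ : ∃ c : ℚ, p' = MvPolynomial.C c := ⟨_, p'.eq_C_of_isEmpty⟩
  exact ⟨c, hp'⟩

/-- **C (polynomial boxes collapse to rational points; registered sub-goal `boxPoly_exists_pt` of
stmt-KontsevichZagierPeriods-3869).** A representation on the open unit box `(0,1)ᵐ` (any `m`) whose
integrand agrees there with a polynomial `p ∈ ℚ[x₀,…,x_{m−1}]` differs by KZ relations from EVERY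
point representation `[pt, q]` over `ℝ⁰` (domain `univ`, constant integrand `q`), for one rational
number `q` (the integral of `p`): glue the box to the cube `[[0,1]ᵐ, p]` (rule 1a), integrate out all
variables (rule 3, `exists_poly_rep_sub_const_rep_mem_relations`), and identify the constant
representation over `[0,1]⁰ = ℝ⁰` with `[pt, q]` by congruence (rule 1b).
[cite: KontsevichZagier2001, §1.2] -/
theorem boxPoly_exists_pt {m : ℕ} (p : MvPolynomial (Fin m) ℚ) (N : IntegralRep m)
    (hNd : N.domain = {x | ∀ i, x i ∈ Set.Ioo (0:ℝ) 1})
    (hNi : EqOn N.integrand (fun x => (MvPolynomial.aeval x p : ℝ)) N.domain) :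
    ∃ q : ℚ, ∀ Z : IntegralRep 0, Z.domain = Set.univ → (Z.integrand = fun _ => (q : ℝ)) →
      of N - of Z ∈ relations := by
  -- glue the open box to the cube representation of `p/1`
  have g1 : KZ.of N - KZ.of (RFun.poly p).rep ∈ KZ.relations :=
    Unicoord.of_sub_of_rep_mem_relations N hNd (RFun.poly p) fun x hx => by
      rw [hNi (hNd ▸ hx), RFun.fn_poly]
  -- integrate out all `m` variables
  obtain ⟨q, g2⟩ := exists_poly_rep_sub_const_rep_mem_relations p
  refine ⟨q, fun Z hZd hZi => ?_⟩
  -- the constant representation over `[0,1]⁰ = ℝ⁰` is congruent to `[pt, q]`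
  have g3 : KZ.of (RFun.const q : RFun 0).rep - KZ.of Z ∈ KZ.relations :=
    of_sub_of_mem_relations_of_eqOn (by rw [hZd, RFun.rep_domain, cube_zero_eq_univ])
      fun x _ => by rw [RFun.rep_integrand, RFun.fn_const, hZi]
  have e : KZ.of N - KZ.of Z =
      (KZ.of N - KZ.of (RFun.poly p).rep) +
      (KZ.of (RFun.poly p).rep - KZ.of (RFun.const q : RFun 0).rep) +
      (KZ.of (RFun.const q : RFun 0).rep - KZ.of Z) := by abel
  rw [e]
  exact KZ.relations.add_mem (KZ.relations.add_mem g1 g2) g3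

end Summit.KontsevichZagierPeriods.HurwitzMicroSectors.NormalFormPrinciple.PiBox.LevelOne
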